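import Mathlib
import HarnessLib
import Summits.HubbardSuperconductivity.HubbardSuperconductivity.Theorems.KLProgrammeFermiSurfaceSharpCurvature

/-!
# Route `KLProgramme` (K1 `H10TwoPointLimit`, K3 `KLRegimeTwoPointLimit`) — sharp band-curve envelopes, part 4:
# the SHARP `BandBounds` bundle on a level range `[a, b] ⊂ (-4, 0)` and its numbers on the certified window

Cell `gate-hubbard-kl`, seat fs-1 (g4), risk r2 (serving r1 «explicit constants»). Parts 1–3
(`KLProgrammeFermiSurfaceSharpTrig/Envelope/Curvature.lean`) bound the eight `BandBounds` quantities pointwise at a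
level `μ`; here the level constants are shown monotone (or endpoint-minimal) in `μ` over a range `a ≤ μ ≤ b`, which
gives the RANGE bundle in closed form — with `d_μ = arccos(-μ/4)`, `K_μ = arccos(-μ/2 - 1)` (`umklappRadius`),
`s_μ = √(-μ(4+μ))/2`, `s_* = min(s_a, s_b)`, `n_μ = (-μ/2)(1 - μ²/16)`, `κ_μ = -μ/√(32 - 2μ²)`:

  `umin = √2 d_a`, `smax = √2 K_b`, `A2 = √2 (K_b²/s_* + 2 K_b)`, `hmin = min(n_a, n_b) · (d_a/sin d_a)²`,
  `amin = κ_b √2 d_a`, `rhomin = s_*`, `cmax = sin d_a/d_a`, `Dtmin = max(√2 s_*, 2 (sin K_b/K_b) √2 d_a)`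

(`klfs_exists_sharpBandBounds`: a `BandBounds a b` term with EXACTLY these fields exists — stated as `∃` so that this
file has no definitions; the named `def` is `KLProgrammeFermiSurfaceSharpBandBounds.lean`). `umin`, `rhomin`, `cmax` are
the true range extrema; `hmin`, `amin` are the true pointwise minima up to endpoint mixing (≤ 7 % on the certified
window); `smax`, `A2`, `Dtmin` are within factors `1.41`, `1.85`, `1.31` of the truth (FS-WINDOW.md §6, kit j252652).
On the certified window `[a, b] = [-0.4267, -0.1798]` (`δ ∈ [0.10, 0.20]`): `umin ≥ 2.06`, `smax ≤ 3.85`, `A2 ≤ 33`,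
`hmin ≥ 0.19`, `amin ≥ 0.0656`, `rhomin ≥ 0.4143`, `cmax ≤ 0.685`, `Dtmin ≥ 0.629`, hence the Gauss constant
**`C_g = π cmax/(2 amin rhomin²) ≤ 96`** (generic bundle: `5.2·10⁴`) and the cell constant `D ≤ 3.52` (generic `10.8`) —
the numeric corollaries are `KLProgrammeFermiSurfaceSharpWindow.lean`; certified table kit j252652 (FS-WINDOW.md §6).
No definitions; everything PROVED. [folklore]
-/

noncomputable section

open Real Set

-- the tree's namespace `Summit.<Summit>.<Problem>.Theorems` repeats the summit name by design (D-0017)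
set_option linter.dupNamespace false

namespace Summit.HubbardSuperconductivity.HubbardSuperconductivity.Theorems

open Literature.MathematicalPhysics.QuantumLattice
open Literature.MathematicalPhysics.QuantumLattice.BandSectorCounting

/-! ### §2 Monotonicity of the level constants over a range -/

section Range

variable {a b : ℝ} (ha : -4 < a) (hab : a ≤ b) (hb : b < 0)
include ha hab hb

omit ha hab hb in
/-- `d_a ≤ d_μ` for `a ≤ μ` (`arccos` is antitone). [folklore] -/
theorem klfs_arccos_quarter_mono {μ : ℝ} (hμ : μ ∈ Icc a b) : Real.arccos (-a / 4) ≤ Real.arccos (-μ / 4) :=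
  Real.antitone_arccos (by linarith [hμ.1])

/-- `0 < d_a < π/2`. [folklore] -/
theorem klfs_arccos_quarter_pos_lt : 0 < Real.arccos (-a / 4) ∧ Real.arccos (-a / 4) < π / 2 :=
  ⟨Real.arccos_pos.2 (by linarith), Real.arccos_lt_pi_div_two.2 (by linarith)⟩

/-- `sin d_μ / d_μ ≤ sin d_a / d_a` for `a ≤ μ ≤ b` (`sin t/t` decreases on `(0, π]`; concavity of `sin`). [folklore] -/
theorem klfs_sinc_arccos_le {μ : ℝ} (hμ : μ ∈ Icc a b) :
    Real.sin (Real.arccos (-μ / 4)) / Real.arccos (-μ / 4) ≤ Real.sin (Real.arccos (-a / 4)) / Real.arccos (-a / 4) := by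
  obtain ⟨hd0, _⟩ := klfs_arccos_quarter_pos_lt ha hab hb
  have hle := klfs_arccos_quarter_mono hμ
  have hπ : Real.arccos (-μ / 4) ≤ π := Real.arccos_le_pi _
  set x := Real.arccos (-a / 4)
  set y := Real.arccos (-μ / 4)
  have hy0 : 0 < y := hd0.trans_le hle
  rcases hle.eq_or_lt with heq | hlt
  · rw [heq]
  have hconv : ConvexOn ℝ (Icc 0 π) (fun t => -Real.sin t) := (strictConcaveOn_sin_Icc.concaveOn).neg
  have h := hconv.secant_mono (a := 0) (x := x) (y := y) ⟨le_rfl, Real.pi_pos.le⟩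
    ⟨hd0.le, hle.trans hπ⟩ ⟨hy0.le, hπ⟩ hd0.ne' hy0.ne' hle
  simp only [Real.sin_zero, neg_zero, sub_zero] at h
  rw [neg_div, neg_div] at h
  linarith

omit ha hab hb in
/-- `K_μ ≤ K_b` for `μ ≤ b`. [folklore] -/
theorem klfs_umklappRadius_le {μ : ℝ} (hμ : μ ∈ Icc a b) : umklappRadius μ ≤ umklappRadius b :=
  umklappRadius_mono hμ.2

/-- `κ_b ≤ κ_μ` for `μ ≤ b` (`κ_μ = -μ/√(32 - 2μ²)` increases with `|μ|`). [folklore] -/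
theorem klfs_kappaMin_antitone {μ : ℝ} (hμ : μ ∈ Icc a b) :
    -b / Real.sqrt (32 - 2 * b ^ 2) ≤ -μ / Real.sqrt (32 - 2 * μ ^ 2) := by
  have hμ0 : μ < 0 := hμ.2.trans_lt hb
  have hμ4 : -4 < μ := ha.trans_le hμ.1
  have h1 : 0 < 32 - 2 * μ ^ 2 := by nlinarith
  have h2 : 0 < 32 - 2 * b ^ 2 := by nlinarith
  have hsq : Real.sqrt (32 - 2 * μ ^ 2) ≤ Real.sqrt (32 - 2 * b ^ 2) := Real.sqrt_le_sqrt (by nlinarith [hμ.2])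
  have hs1 : 0 < Real.sqrt (32 - 2 * μ ^ 2) := Real.sqrt_pos.2 h1
  calc -b / Real.sqrt (32 - 2 * b ^ 2) ≤ -μ / Real.sqrt (32 - 2 * b ^ 2) :=
        div_le_div_of_nonneg_right (by linarith [hμ.2]) (Real.sqrt_pos.2 h2).le
    _ ≤ -μ / Real.sqrt (32 - 2 * μ ^ 2) := div_le_div_of_nonneg_left (by linarith) hs1 hsq

omit ha hab hb in
/-- The level product `-μ(4+μ)` is concave: `min(-a(4+a), -b(4+b)) ≤ -μ(4+μ)` on `[a, b]`. [folklore] -/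
theorem klfs_levelProduct_ge_min {μ : ℝ} (hμ : μ ∈ Icc a b) : min (-a * (4 + a)) (-b * (4 + b)) ≤ -μ * (4 + μ) := by
  rcases le_or_gt μ (-2) with h | h
  · have h1 : 0 ≤ (μ - a) * (-(a + μ + 4)) := mul_nonneg (by linarith [hμ.1]) (by linarith [hμ.1])
    have : -a * (4 + a) ≤ -μ * (4 + μ) := by nlinarith [h1]
    exact (min_le_left _ _).trans this
  · have h1 : 0 ≤ (b - μ) * (b + μ + 4) := mul_nonneg (by linarith [hμ.2]) (by linarith [hμ.2])
    have : -b * (4 + b) ≤ -μ * (4 + μ) := by nlinarith [h1]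
    exact (min_le_right _ _).trans this

omit ha hab hb in
/-- `s_* = min(s_a, s_b) ≤ s_μ` with `s_μ = √(-μ(4+μ))/2`. [folklore] -/
theorem klfs_levelSin_ge_min {μ : ℝ} (hμ : μ ∈ Icc a b) :
    min (Real.sqrt (-a * (4 + a)) / 2) (Real.sqrt (-b * (4 + b)) / 2) ≤ Real.sqrt (-μ * (4 + μ)) / 2 := by
  have h := klfs_levelProduct_ge_min hμ
  rcases min_choice (-a * (4 + a)) (-b * (4 + b)) with hm | hm
  · rw [hm] at h
    exact (min_le_left _ _).trans (by gcongr)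
  · rw [hm] at h
    exact (min_le_right _ _).trans (by gcongr)

/-- `0 < s_*`. [folklore] -/
theorem klfs_levelSin_min_pos : 0 < min (Real.sqrt (-a * (4 + a)) / 2) (Real.sqrt (-b * (4 + b)) / 2) := by
  have h1 : 0 < -a * (4 + a) := by nlinarith
  have h2 : 0 < -b * (4 + b) := by nlinarith
  exact lt_min (by positivity) (by positivity)

omit ha in
/-- The convexity numerator `n_μ = (-μ/2)(1 - μ²/16) = m (1 - m²/4)` is concave in `m`, hence
`min(n_a, n_b) ≤ n_μ` on `[a, b]`. [folklore] -/
theorem klfs_levelN_ge_min {μ : ℝ} (hμ : μ ∈ Icc a b) :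
    min (-a / 2 * (1 - a ^ 2 / 16)) (-b / 2 * (1 - b ^ 2 / 16)) ≤ -μ / 2 * (1 - μ ^ 2 / 16) := by
  -- `n(μ) - n(ν) = (ν - μ)(16 - (ν² + νμ + μ²))/32`; unimodal with maximum at `3μ² = 16`
  have hμ0 : μ < 0 := hμ.2.trans_lt hb
  rcases le_or_gt (3 * μ ^ 2) 16 with h | h
  · -- `n` increases on `[μ, b]` (towards 0 it decreases): compare with `b`
    have hb2 : b ^ 2 ≤ μ ^ 2 := by nlinarith [mul_nonneg (sub_nonneg.2 hμ.2) (by linarith : 0 ≤ -(b + μ))]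
    have hbμ : b * μ ≤ μ ^ 2 := by nlinarith [mul_nonneg (sub_nonneg.2 hμ.2) (by linarith : 0 ≤ -μ)]
    have hq : b ^ 2 + b * μ + μ ^ 2 ≤ 16 := by nlinarith
    have h1 : 0 ≤ (b - μ) * (16 - (b ^ 2 + b * μ + μ ^ 2)) := mul_nonneg (by linarith [hμ.2]) (by linarith)
    have : -b / 2 * (1 - b ^ 2 / 16) ≤ -μ / 2 * (1 - μ ^ 2 / 16) := by nlinarith [h1]
    exact (min_le_right _ _).trans this
  · have ha2 : μ ^ 2 ≤ a ^ 2 := by nlinarith [mul_nonneg (sub_nonneg.2 hμ.1) (by linarith [hμ.1] : 0 ≤ -(a + μ))]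
    have hq : 16 ≤ a ^ 2 + a * μ + μ ^ 2 := by nlinarith [sq_nonneg (a - μ), hμ.1]
    have h1 : 0 ≤ (μ - a) * (a ^ 2 + a * μ + μ ^ 2 - 16) := mul_nonneg (by linarith [hμ.1]) (by linarith)
    have : -a / 2 * (1 - a ^ 2 / 16) ≤ -μ / 2 * (1 - μ ^ 2 / 16) := by nlinarith [h1]
    exact (min_le_left _ _).trans this

/-- `0 < min(n_a, n_b)`. [folklore] -/
theorem klfs_levelN_min_pos : 0 < min (-a / 2 * (1 - a ^ 2 / 16)) (-b / 2 * (1 - b ^ 2 / 16)) := by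
  have h1 : 0 < 1 - a ^ 2 / 16 := by nlinarith
  have h2 : 0 < 1 - b ^ 2 / 16 := by nlinarith
  exact lt_min (mul_pos (by linarith) h1) (mul_pos (by linarith) h2)

/-! ### §3 The sharp range envelopes (the eight `BandBounds` fields) -/

omit hab in
/-- **Radius: `√2 d_a ≤ u`** on the range (exact range minimum). [folklore] -/
theorem klfs_sharp_umin_le {μ : ℝ} (hμ : μ ∈ Icc a b) (θ : ℝ) :
    Real.sqrt 2 * Real.arccos (-a / 4) ≤ bandFermiRadius μ θ :=
  (mul_le_mul_of_nonneg_left (klfs_arccos_quarter_mono hμ) (Real.sqrt_nonneg 2)).trans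
    (klfs_sqrt_two_mul_arccos_le_bandFermiRadius (ha.trans_le hμ.1) (hμ.2.trans_lt hb) θ)

omit hab in
/-- **Speed: `|x'| ≤ √2 K_b`**. [folklore] -/
theorem klfs_sharp_abs_bandVX_le {μ : ℝ} (hμ : μ ∈ Icc a b) (θ : ℝ) : |bandVX μ θ| ≤ Real.sqrt 2 * umklappRadius b :=
  (klfs_abs_bandVX_le (ha.trans_le hμ.1) (hμ.2.trans_lt hb) θ).trans (mul_le_mul_of_nonneg_left
    ((klfs_bandFermiRadius_le_umklappRadius (ha.trans_le hμ.1) (hμ.2.trans_lt hb) θ).trans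
      (klfs_umklappRadius_le hμ)) (Real.sqrt_nonneg 2))

omit hab in
/-- **Speed: `|y'| ≤ √2 K_b`**. [folklore] -/
theorem klfs_sharp_abs_bandVY_le {μ : ℝ} (hμ : μ ∈ Icc a b) (θ : ℝ) : |bandVY μ θ| ≤ Real.sqrt 2 * umklappRadius b :=
  (klfs_abs_bandVY_le (ha.trans_le hμ.1) (hμ.2.trans_lt hb) θ).trans (mul_le_mul_of_nonneg_left
    ((klfs_bandFermiRadius_le_umklappRadius (ha.trans_le hμ.1) (hμ.2.trans_lt hb) θ).trans
      (klfs_umklappRadius_le hμ)) (Real.sqrt_nonneg 2))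

omit ha hab hb in
/-- The acceleration constant is monotone in its ingredients: `√2 (K²/s + 2K) ≤ √2 (K'²/s' + 2K')` for
`0 ≤ K ≤ K'`, `0 < s' ≤ s`. [folklore] -/
theorem klfs_accel_const_mono {K K' s s' : ℝ} (hK : 0 ≤ K) (hKK : K ≤ K') (hs' : 0 < s') (hss : s' ≤ s) :
    Real.sqrt 2 * (K ^ 2 / s + 2 * K) ≤ Real.sqrt 2 * (K' ^ 2 / s' + 2 * K') := by
  have hs : 0 < s := hs'.trans_le hss
  refine mul_le_mul_of_nonneg_left ?_ (Real.sqrt_nonneg 2)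
  have h1 : K ^ 2 / s ≤ K' ^ 2 / s' :=
    (div_le_div_of_nonneg_right (pow_le_pow_left₀ hK hKK 2) hs.le).trans
      (div_le_div_of_nonneg_left (sq_nonneg K') hs' hss)
  linarith

/-- **Acceleration: `|x''| ≤ √2 (K_b²/s_* + 2 K_b)`**. [folklore] -/
theorem klfs_sharp_abs_bandAX_le {μ : ℝ} (hμ : μ ∈ Icc a b) (θ : ℝ) :
    |bandAX μ θ| ≤ Real.sqrt 2 * (umklappRadius b ^ 2 /
      min (Real.sqrt (-a * (4 + a)) / 2) (Real.sqrt (-b * (4 + b)) / 2) + 2 * umklappRadius b) := by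
  have h1 := ha.trans_le hμ.1
  have h2 := hμ.2.trans_lt hb
  exact (klfs_abs_bandAX_le h1 h2 θ).trans (klfs_accel_const_mono (umklappRadius_pos h1).le
    (klfs_umklappRadius_le hμ) (klfs_levelSin_min_pos ha hab hb) (klfs_levelSin_ge_min hμ))

/-- **Acceleration: `|y''| ≤ √2 (K_b²/s_* + 2 K_b)`**. [folklore] -/
theorem klfs_sharp_abs_bandAY_le {μ : ℝ} (hμ : μ ∈ Icc a b) (θ : ℝ) :
    |bandAY μ θ| ≤ Real.sqrt 2 * (umklappRadius b ^ 2 /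
      min (Real.sqrt (-a * (4 + a)) / 2) (Real.sqrt (-b * (4 + b)) / 2) + 2 * umklappRadius b) := by
  have h1 := ha.trans_le hμ.1
  have h2 := hμ.2.trans_lt hb
  exact (klfs_abs_bandAY_le h1 h2 θ).trans (klfs_accel_const_mono (umklappRadius_pos h1).le
    (klfs_umklappRadius_le hμ) (klfs_levelSin_min_pos ha hab hb) (klfs_levelSin_ge_min hμ))

/-- **Convexity: `min(n_a, n_b) · (d_a/sin d_a)² ≤ H`**. [folklore] -/
theorem klfs_sharp_hess_ge {μ : ℝ} (hμ : μ ∈ Icc a b) (θ : ℝ) :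
    min (-a / 2 * (1 - a ^ 2 / 16)) (-b / 2 * (1 - b ^ 2 / 16)) /
        (Real.sin (Real.arccos (-a / 4)) / Real.arccos (-a / 4)) ^ 2 ≤
      Real.cos (bandX μ θ) * bandVX μ θ ^ 2 + Real.cos (bandY μ θ) * bandVY μ θ ^ 2 := by
  have h1 := ha.trans_le hμ.1
  have h2 := hμ.2.trans_lt hb
  have hH := bandHess_pos h1 h2 θ
  have hge := klfs_hess_mul_sinc_sq_ge h1 h2 θ
  have hn := klfs_levelN_ge_min hab hb hμ
  have hsinc := klfs_sinc_arccos_le ha hab hb hμ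
  obtain ⟨hd0, hdlt⟩ := klfs_arccos_quarter_pos_lt ha hab hb
  have hsincμ_pos : 0 < Real.sin (Real.arccos (-μ / 4)) / Real.arccos (-μ / 4) := by
    have hdμ0 : 0 < Real.arccos (-μ / 4) := Real.arccos_pos.2 (by linarith)
    have hdμπ : Real.arccos (-μ / 4) < π := by
      have := Real.arccos_lt_pi_div_two.2 (show 0 < -μ / 4 by linarith); linarith [Real.pi_pos]
    exact div_pos (Real.sin_pos_of_pos_of_lt_pi hdμ0 hdμπ) hdμ0
  have hsinca_pos : 0 < Real.sin (Real.arccos (-a / 4)) / Real.arccos (-a / 4) :=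
    div_pos (Real.sin_pos_of_pos_of_lt_pi hd0 (by linarith [Real.pi_pos])) hd0
  rw [div_le_iff₀ (pow_pos hsinca_pos 2)]
  have hsq : (Real.sin (Real.arccos (-μ / 4)) / Real.arccos (-μ / 4)) ^ 2 ≤
      (Real.sin (Real.arccos (-a / 4)) / Real.arccos (-a / 4)) ^ 2 := pow_le_pow_left₀ hsincμ_pos.le hsinc 2
  calc min (-a / 2 * (1 - a ^ 2 / 16)) (-b / 2 * (1 - b ^ 2 / 16)) ≤ -μ / 2 * (1 - μ ^ 2 / 16) := hn
    _ ≤ _ := hge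
    _ ≤ _ := mul_le_mul_of_nonneg_left hsq hH.le

/-- **Gauss-map rate: `κ_b √2 d_a ≤ α'`**. [folklore] -/
theorem klfs_sharp_bandNormalAngleDeriv_ge {μ : ℝ} (hμ : μ ∈ Icc a b) (θ : ℝ) :
    -b / Real.sqrt (32 - 2 * b ^ 2) * (Real.sqrt 2 * Real.arccos (-a / 4)) ≤ bandNormalAngleDeriv μ θ := by
  have h1 := ha.trans_le hμ.1
  have h2 := hμ.2.trans_lt hb
  have hκ := klfs_kappaMin_antitone ha hab hb hμ
  have hκb : 0 ≤ -b / Real.sqrt (32 - 2 * b ^ 2) := div_nonneg (by linarith) (Real.sqrt_nonneg _)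
  have hd := klfs_arccos_quarter_mono hμ
  calc -b / Real.sqrt (32 - 2 * b ^ 2) * (Real.sqrt 2 * Real.arccos (-a / 4))
      ≤ -μ / Real.sqrt (32 - 2 * μ ^ 2) * (Real.sqrt 2 * Real.arccos (-μ / 4)) :=
        mul_le_mul hκ (mul_le_mul_of_nonneg_left hd (Real.sqrt_nonneg 2))
          (mul_nonneg (Real.sqrt_nonneg 2) (Real.arccos_nonneg _)) ((klfs_curvature_lower_pos h1 h2).le)
    _ ≤ _ := klfs_bandNormalAngleDeriv_ge_node h1 h2 θ

/-- **The Gauss map expands at the sharp rate**: `κ_b √2 d_a · |θ - θ'| ≤ |α(θ) - α(θ')|`. [folklore] -/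
theorem klfs_sharp_gauss_expand {μ : ℝ} (hμ : μ ∈ Icc a b) (θ θ' : ℝ) :
    -b / Real.sqrt (32 - 2 * b ^ 2) * (Real.sqrt 2 * Real.arccos (-a / 4)) * |θ - θ'| ≤
      |bandNormalAngle μ θ - bandNormalAngle μ θ'| := by
  have h1 := ha.trans_le hμ.1
  have h2 := hμ.2.trans_lt hb
  set A := -b / Real.sqrt (32 - 2 * b ^ 2) * (Real.sqrt 2 * Real.arccos (-a / 4))
  have hd : ∀ z, HasDerivAt (bandNormalAngle μ) (bandNormalAngleDeriv μ z) z := hasDerivAt_bandNormalAngle h1 h2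
  have hmono : ∀ x y : ℝ, x ≤ y → A * (y - x) ≤ bandNormalAngle μ y - bandNormalAngle μ x := by
    intro x y hxy
    exact (convex_Icc x y).mul_sub_le_image_sub_of_le_deriv
      (fun z _ => (hd z).continuousAt.continuousWithinAt)
      (fun z _ => (hd z).differentiableAt.differentiableWithinAt)
      (fun z _ => by rw [(hd z).deriv]; exact klfs_sharp_bandNormalAngleDeriv_ge ha hab hb hμ z) x
      (left_mem_Icc.2 hxy) y (right_mem_Icc.2 hxy) hxy
  rcases le_total θ θ' with h | h
  · rw [abs_of_nonpos (sub_nonpos.2 h), abs_sub_comm]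
    calc A * -(θ - θ') = A * (θ' - θ) := by ring
      _ ≤ _ := (hmono θ θ' h).trans (le_abs_self _)
  · rw [abs_of_nonneg (sub_nonneg.2 h)]
    exact (hmono θ' θ h).trans (le_abs_self _)

omit hab in
/-- **Gradient: `s_* ≤ ρ`** (exact range minimum). [folklore] -/
theorem klfs_sharp_rho_ge {μ : ℝ} (hμ : μ ∈ Icc a b) (θ : ℝ) :
    min (Real.sqrt (-a * (4 + a)) / 2) (Real.sqrt (-b * (4 + b)) / 2) ≤
      Real.sqrt (Real.sin (bandX μ θ) ^ 2 + Real.sin (bandY μ θ) ^ 2) :=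
  (klfs_levelSin_ge_min hμ).trans (klfs_levelSin_le_rho (ha.trans_le hμ.1) (hμ.2.trans_lt hb) θ)

/-- **Normal coefficient: `c ≤ sin d_a/d_a`** (exact range maximum). [folklore] -/
theorem klfs_sharp_bandNormalCoeff_le {μ : ℝ} (hμ : μ ∈ Icc a b) (θ : ℝ) :
    bandNormalCoeff μ θ ≤ Real.sin (Real.arccos (-a / 4)) / Real.arccos (-a / 4) :=
  (klfs_bandNormalCoeff_le_sinc (ha.trans_le hμ.1) (hμ.2.trans_lt hb) θ).trans (klfs_sinc_arccos_le ha hab hb hμ)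

/-- **Radial transversality: `max(√2 s_*, 2 (sin K_b/K_b) √2 d_a) ≤ ∂_t F(θ, u)`** — the first form is
`∂_t F = 2uc ≥ √2 ρ`, the second the tree's chord bound `∂_t F ≥ 2 (sin K_b/K_b) u` with the sharp `umin`. [folklore] -/
theorem klfs_sharp_Dt_ge {μ : ℝ} (hμ : μ ∈ Icc a b) (θ : ℝ) :
    max (Real.sqrt 2 * min (Real.sqrt (-a * (4 + a)) / 2) (Real.sqrt (-b * (4 + b)) / 2))
        (2 * cQ b * (Real.sqrt 2 * Real.arccos (-a / 4))) ≤
      rayDispersionDt θ (bandFermiRadius μ θ) := by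
  refine max_le ?_ ?_
  · exact (mul_le_mul_of_nonneg_left (klfs_sharp_rho_ge ha hb hμ θ) (Real.sqrt_nonneg 2)).trans
      (klfs_rayDispersionDt_ge_sqrt_two_mul_rho (ha.trans_le hμ.1) (hμ.2.trans_lt hb) θ)
  · exact (mul_le_mul_of_nonneg_left (klfs_sharp_umin_le ha hb hμ θ)
      (by have := cQ_pos ha hab hb; positivity)).trans (Dt_ge_q ha hab hb hμ θ)

/-- **The SHARP bundle exists**: a `BandBounds a b` term whose eight fields are the closed forms of the module
docstring. (No `def` here; `KLProgrammeFermiSurfaceSharpBandBounds.lean` names it.) [folklore] -/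
theorem klfs_exists_sharpBandBounds :
    ∃ B : BandBounds a b,
      B.umin = Real.sqrt 2 * Real.arccos (-a / 4) ∧
      B.smax = Real.sqrt 2 * umklappRadius b ∧
      B.A2 = Real.sqrt 2 * (umklappRadius b ^ 2 /
        min (Real.sqrt (-a * (4 + a)) / 2) (Real.sqrt (-b * (4 + b)) / 2) + 2 * umklappRadius b) ∧
      B.hmin = min (-a / 2 * (1 - a ^ 2 / 16)) (-b / 2 * (1 - b ^ 2 / 16)) /
        (Real.sin (Real.arccos (-a / 4)) / Real.arccos (-a / 4)) ^ 2 ∧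
      B.amin = -b / Real.sqrt (32 - 2 * b ^ 2) * (Real.sqrt 2 * Real.arccos (-a / 4)) ∧
      B.rhomin = min (Real.sqrt (-a * (4 + a)) / 2) (Real.sqrt (-b * (4 + b)) / 2) ∧
      B.cmax = Real.sin (Real.arccos (-a / 4)) / Real.arccos (-a / 4) ∧
      B.Dtmin = max (Real.sqrt 2 * min (Real.sqrt (-a * (4 + a)) / 2) (Real.sqrt (-b * (4 + b)) / 2))
        (2 * cQ b * (Real.sqrt 2 * Real.arccos (-a / 4))) := by
  obtain ⟨hd0, hdlt⟩ := klfs_arccos_quarter_pos_lt ha hab hb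
  have hsinc : 0 < Real.sin (Real.arccos (-a / 4)) / Real.arccos (-a / 4) :=
    div_pos (Real.sin_pos_of_pos_of_lt_pi hd0 (by linarith [Real.pi_pos])) hd0
  have hs := klfs_levelSin_min_pos ha hab hb
  have hK : 0 < umklappRadius b := umklappRadius_pos (by linarith)
  have hκb : 0 < -b / Real.sqrt (32 - 2 * b ^ 2) := div_pos (by linarith) (Real.sqrt_pos.2 (by nlinarith))
  have h2 : 0 < Real.sqrt 2 := Real.sqrt_pos.2 (by norm_num)
  exact ⟨⟨ha, hb,
      Real.sqrt 2 * Real.arccos (-a / 4),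
      Real.sqrt 2 * umklappRadius b,
      Real.sqrt 2 * (umklappRadius b ^ 2 /
        min (Real.sqrt (-a * (4 + a)) / 2) (Real.sqrt (-b * (4 + b)) / 2) + 2 * umklappRadius b),
      min (-a / 2 * (1 - a ^ 2 / 16)) (-b / 2 * (1 - b ^ 2 / 16)) /
        (Real.sin (Real.arccos (-a / 4)) / Real.arccos (-a / 4)) ^ 2,
      -b / Real.sqrt (32 - 2 * b ^ 2) * (Real.sqrt 2 * Real.arccos (-a / 4)),
      min (Real.sqrt (-a * (4 + a)) / 2) (Real.sqrt (-b * (4 + b)) / 2),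
      Real.sin (Real.arccos (-a / 4)) / Real.arccos (-a / 4),
      max (Real.sqrt 2 * min (Real.sqrt (-a * (4 + a)) / 2) (Real.sqrt (-b * (4 + b)) / 2))
        (2 * cQ b * (Real.sqrt 2 * Real.arccos (-a / 4))),
      by positivity, by positivity, by positivity, div_pos (klfs_levelN_min_pos ha hab hb) (pow_pos hsinc 2),
      by positivity, hs, hsinc, lt_max_of_lt_left (by positivity),
      fun μ hμ θ => klfs_sharp_umin_le ha hb hμ θ,
      fun μ hμ θ => klfs_sharp_abs_bandVX_le ha hb hμ θ,
      fun μ hμ θ => klfs_sharp_abs_bandVY_le ha hb hμ θ,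
      fun μ hμ θ => klfs_sharp_abs_bandAX_le ha hab hb hμ θ,
      fun μ hμ θ => klfs_sharp_abs_bandAY_le ha hab hb hμ θ,
      fun μ hμ θ => klfs_sharp_hess_ge ha hab hb hμ θ,
      fun μ hμ θ θ' => klfs_sharp_gauss_expand ha hab hb hμ θ θ',
      fun μ hμ θ => klfs_sharp_rho_ge ha hb hμ θ,
      fun μ hμ θ => klfs_sharp_bandNormalCoeff_le ha hab hb hμ θ,
      fun μ hμ θ => klfs_sharp_Dt_ge ha hab hb hμ θ⟩,
    rfl, rfl, rfl, rfl, rfl, rfl, rfl, rfl⟩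

end Range

end Summit.HubbardSuperconductivity.HubbardSuperconductivity.Theorems

end
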